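import Literature.Barriers.RiemannHypothesis.JensenPolynomials
import Literature.Analysis.Complex.JensenPolynomialSector
import Literature.NumberTheory.LFunctions.XiMultiplePositivityProofs
import Literature.NumberTheory.LFunctions.RHWave0
import HarnessLib

/-!
# Chasse's theorem: RH up to height `T` makes `J^{d,0}_γ` hyperbolic for `d ≤ T²` (proved), and
# `GORZ2019_chasse` from the Platt–Trudgian verification

Sibling file of `Literature/Barriers/RiemannHypothesis/JensenPolynomials.lean`, which vendors the
named fact `Literature.Barriers.RiemannHypothesis.GORZ2019_chasse`: GORZ, PNAS 116 (2019), §1,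
footnote — "The hyperbolicity for `J^{d,0}_γ(X)` has been confirmed for `d ≤ 2·10^17` by Chasse
(cf. Theorem 1.8 of [Chasse])" — where `γ = Literature.NumberTheory.LFunctions.xiTaylorCoeff` are the
Taylor coefficients `(-1 + 4z²) Λ(½ + z) = Σ γ(n) z^{2n}/n!` and "hyperbolic" = `Polynomial.Splits`
over `ℝ`.

What Chasse's theorem says (Farmer 2022, §4): "Chasse [Ch, Cha] proved that if all the zeros
`ρ = β + iγ` of the zeta-function are on the critical line for `|γ| < T`, then `J^{d,0}` has only
real zeros for `d < T²`." The mechanism (Kim–Lee 2021, p. 2, Remark and Theorem 4 with its Remark: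
"`J(Ξ₀⁽ⁿ⁾; d)` is hyperbolic for `d ≤ T²(1 + 4⁻¹T⁻²)²` … Currently, it is known [Platt–Trudgian]
that `Z(Ξ) ⊂ 𝕊(T)` for some `T ≥ 3·10^12`. Thus … `J(Ξ₀⁽ⁿ⁾; d)` is hyperbolic for `d ≤ 9·10^24`"):
Obreschkoff's sector theorem plus polynomial approximation of the genus-zero function
`G(w) = ξ(½ + √w)` (`Literature.NumberTheory.LFunctions.xiSq`, with `γ(k) = 8 G⁽ᵏ⁾(0)`), whose
zeros `(ρ - ½)²` lie in the sector `S(1/T) = {|Im z| ≤ |z|/T}` as soon as the zeros `ρ` with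
`|Im ρ| < T` are on the line (`|Im (ρ-½)²| = 2|β-½||γ| ≤ |γ| ≤ |ρ-½|²/T` for `|γ| ≥ T`).

## Contents (all proved; no new definitions)

* `xiSq_zeros_mem_sector` — RH for `0 < Im ρ < T` puts the zeros of `G` in `S(1/T)`.
* `jensenPoly_xiTaylorCoeff_splits_of_rh_upTo` — **Chasse's theorem**: if every zero of `ζ` with
  `0 < Im ρ < T` has `Re ρ = ½`, then `J^{d,0}_γ` splits over `ℝ` for every `d ≤ T²`
  (`Literature.Analysis.Complex.Obreschkoff.splits_jensenPoly_taylor_of_zeros_mem_sector` applied to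
  `G`: Hadamard in genus zero, real approximants, Obreschkoff, limits — all theorems of the tree).
* `GORZ2019_chasse_of_platt_trudgian_numerical_rh` — the named fact `GORZ2019_chasse`
  (`d ≤ 2·10^17`) follows from the tree's named fact
  `Literature.NumberTheory.LFunctions.platt_trudgian_numerical_rh` (RH to height `3 000 175 332 800`,
  Platt–Trudgian 2021 Thm. 1; a certified computation, the only unproved input), indeed with
  Kim–Lee's range `d ≤ 9·10^24` (`jensenPoly_xiTaylorCoeff_splits_of_platt_trudgian`).

The unconditional discharge `GORZ2019_chasse_holds` would require a kernel proof of a numerical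
verification of RH to height `≥ √(2·10^17) ≈ 4.5·10^8`; it is NOT attempted. Chasse's own input was
an earlier verification (his constant `2·10^17` corresponds to `T ≈ 4.5·10^8`); his paper
(Complex Var. Elliptic Equ. 58 (2013)) is paywalled and was not read — the statement used is the one
printed by Farmer and by Kim–Lee.

## References

* [GORZPNAS2019] M. Griffin, K. Ono, L. Rolen, D. Zagier, PNAS 116 (2019), §1 footnote.
* [Chasse2013] M. Chasse, *Laguerre multiplier sequences and sector properties of entire
  functions*, Complex Var. Elliptic Equ. 58 (2013), 875–885, Thm. 1.8 (cited through GORZ, Farmer,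
  Kim–Lee; not read).
* [Farmer2022] D. W. Farmer, Adv. Math. 411 (2022), §4 (the statement of Chasse's theorem).
* [KimLee2021] Y.-O. Kim, J. Lee, arXiv:2105.05386, Thm. 3, Thm. 4 and Remarks (pp. 1–2).
* [PlattTrudgianBLMS2021] D. Platt, T. Trudgian, Bull. LMS 53 (2021), Thm. 1.
-/

noncomputable section

open Polynomial Filter
open _root_.Complex _root_.Topology
open scoped ComplexConjugate Nat

namespace Literature.Barriers.RiemannHypothesis

open Literature.NumberTheory.LFunctions Literature.Analysis.Complex.Obreschkoff
  Literature.Analysis.Complex.PolyaSchur Literature.Analysis.TotalPositivity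

/-! ## The zeros of `G` under RH up to height `T` -/

/-- Zeros of `G` (`G(w²) = ξ(½ + w)`) come from nontrivial zeros of `ζ`: if `G z = 0` then
`z = (ρ - ½)²` with `ζ(ρ) = 0`, `0 < Re ρ < 1`. [cite: Titchmarsh1986, §2.12] -/
theorem exists_zero_of_xiSq_eq_zero {z : ℂ} (hz : xiSq z = 0) :
    ∃ ρ : ℂ, riemannZeta ρ = 0 ∧ 0 < ρ.re ∧ ρ.re < 1 ∧ (ρ - 1 / 2) ^ 2 = z := by
  rw [xiSq_eq] at hz
  obtain ⟨h1, h2, h3⟩ := (riemannXi_eq_zero_iff_holds _).1 hz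
  refine ⟨_, h1, h2, h3, ?_⟩
  rw [add_sub_cancel_left]
  exact_mod_cast Complex.cpow_nat_inv_pow z two_ne_zero

/-- From the printed shape of a numerical verification of RH ("every zero with `0 < Im s < T` has
`Re s = ½`") to all zeros of the open critical strip with `|Im s| < T`: zeros come in conjugate
pairs (`ξ(s̄) = conj ξ(s)`) and `ζ` has no zeros on `(0, 1)`. [cite: Titchmarsh1986, §2.12] -/
theorem re_eq_half_of_rh_upTo {T : ℝ}
    (hRH : ∀ s : ℂ, riemannZeta s = 0 → 0 < s.im → s.im < T → s.re = 1 / 2)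
    {s : ℂ} (hs : riemannZeta s = 0) (h0 : 0 < s.re) (h1 : s.re < 1) (hT : |s.im| < T) :
    s.re = 1 / 2 := by
  rcases lt_trichotomy s.im 0 with him | him | him
  · have hξ : riemannXi s = 0 := (riemannXi_eq_zero_iff_holds s).2 ⟨hs, h0, h1⟩
    have hξ' : riemannXi (conj s) = 0 := by rw [riemannXi_conj_holds, hξ, map_zero]
    obtain ⟨hs', -, -⟩ := (riemannXi_eq_zero_iff_holds _).1 hξ'
    have h := hRH (conj s) hs' (by simpa using him)
      (by rw [conj_im]; rw [abs_of_neg him] at hT; exact hT)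
    simpa using h
  · exact absurd hs (riemannZeta_ne_zero_of_im_eq_zero_of_pos_of_lt_one him h0 h1)
  · exact hRH s hs him (by rwa [abs_of_pos him] at hT)

/-- **The geometry of Chasse's theorem** (Kim–Lee 2021, proof of Thm. 4 / Remark): if every zero of
`ζ` with `0 < Im ρ < T` (`T > 0`) lies on the critical line, then every zero `(ρ - ½)²` of `G` lies
in the sector `S(1/T) = {|Im z| ≤ |z|/T}`: on-line zeros give real points `-γ²`, and for `|γ| ≥ T`,
`|Im (ρ-½)²| = 2|β-½||γ| ≤ |γ| ≤ (β-½)² + γ²)/T`. [cite: KimLee2021, Theorem 4 and Remark (p. 2)] -/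
theorem xiSq_zeros_mem_sector {T : ℝ} (hT : 0 < T)
    (hRH : ∀ s : ℂ, riemannZeta s = 0 → 0 < s.im → s.im < T → s.re = 1 / 2)
    {z : ℂ} (hz : xiSq z = 0) : z ∈ sector T⁻¹ := by
  obtain ⟨ρ, hζ, h0, h1, rfl⟩ := exists_zero_of_xiSq_eq_zero hz
  rw [mem_sector]
  have him2 : ((ρ - 1 / 2) ^ 2).im = 2 * (ρ.re - 1 / 2) * ρ.im := by
    simp [sq]; ring
  have hnorm : ‖(ρ - 1 / 2) ^ 2‖ = (ρ.re - 1 / 2) ^ 2 + ρ.im ^ 2 := by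
    rw [norm_pow, Complex.sq_norm, normSq_apply]
    simp; ring
  by_cases hyT : |ρ.im| < T
  · have hx : ρ.re - 1 / 2 = 0 := by rw [re_eq_half_of_rh_upTo hRH hζ h0 h1 hyT, sub_self]
    rw [him2, hx, mul_zero, zero_mul, abs_zero]
    positivity
  · push Not at hyT
    have hx : |ρ.re - 1 / 2| ≤ 1 / 2 := by rw [abs_le]; constructor <;> linarith
    rw [him2, hnorm, le_inv_mul_iff₀ hT]
    have hy0 : 0 ≤ |ρ.im| := abs_nonneg _
    calc T * |2 * (ρ.re - 1 / 2) * ρ.im| = T * (2 * |ρ.re - 1 / 2| * |ρ.im|) := by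
          rw [abs_mul, abs_mul, abs_two]
      _ ≤ T * |ρ.im| := by
          refine mul_le_mul_of_nonneg_left ?_ hT.le
          nlinarith
      _ ≤ |ρ.im| * |ρ.im| := mul_le_mul_of_nonneg_right hyT hy0
      _ = ρ.im ^ 2 := by rw [← sq, sq_abs]
      _ ≤ (ρ.re - 1 / 2) ^ 2 + ρ.im ^ 2 := le_add_of_nonneg_left (sq_nonneg _)

/-! ## Chasse's theorem -/

/-- The Taylor coefficients of `G` at `0` are `γ(k)/8`. [cite: GORZPNAS2019, eq. (1)] -/
theorem re_iteratedDeriv_xiSq (k : ℕ) : (iteratedDeriv k xiSq 0).re = 8⁻¹ * xiTaylorCoeff k := by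
  have h1 := re_iteratedDeriv_xiSq_div k
  have hk : (k ! : ℝ) ≠ 0 := by positivity
  rw [← mul_div_assoc, div_left_inj' hk] at h1
  exact h1

/-- **Chasse's theorem** (Chasse 2013, Thm. 1.8, as stated by Farmer 2022, §4: "if all the zeros
`ρ = β + iγ` of the zeta-function are on the critical line for `|γ| < T`, then `J^{d,0}` has only real
zeros for `d < T²`"; Kim–Lee 2021, Remark after Thm. 4). If every zero `ρ` of `ζ` with
`0 < Im ρ < T` has `Re ρ = ½` (`T > 0`), then the Jensen polynomial `J^{d,0}_γ` of the Taylor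
coefficients `γ` of `(-1+4z²)Λ(½+z)` splits over `ℝ` for every `d ≤ T²`. Proof: the tree's
`splits_jensenPoly_taylor_of_zeros_mem_sector` (Hadamard genus `0` + real approximants +
Obreschkoff's theorem + limits) for `G = xiSq` (order `≤ 7/8 < 1`, real, `G(0) = ξ(½) ≠ 0`, zeros in
`S(1/T)`), and `γ(k) = 8 Re G⁽ᵏ⁾(0)`.
[cite: Farmer2022, §4] [cite: KimLee2021, Theorem 4 and Remark] [cite: Chasse2013, Theorem 1.8] -/
theorem jensenPoly_xiTaylorCoeff_splits_of_rh_upTo {T : ℝ} (hT : 0 < T)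
    (hRH : ∀ s : ℂ, riemannZeta s = 0 → 0 < s.im → s.im < T → s.re = 1 / 2)
    {d : ℕ} (hd : (d : ℝ) ≤ T ^ 2) :
    (jensenPoly xiTaylorCoeff d 0).Splits := by
  obtain ⟨C, hC⟩ := norm_xiSq_le
  have hF : IsEntireOfOrderLtOne xiSq := ⟨differentiable_xiSq, 7 / 8, C, by norm_num, hC⟩
  have hδ : (d : ℝ) * T⁻¹ ^ 2 ≤ 1 := by
    rw [inv_pow, ← div_eq_mul_inv]
    exact div_le_one_of_le₀ hd (by positivity)
  have h := splits_jensenPoly_taylor_of_zeros_mem_sector hF xiSq_conj xiSq_zero_ne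
    (fun z hz => xiSq_zeros_mem_sector hT hRH hz) hδ
  have hcoef : (fun k => (iteratedDeriv k xiSq 0).re) = fun k => 8⁻¹ * xiTaylorCoeff k :=
    funext re_iteratedDeriv_xiSq
  rw [hcoef, jensenPoly_const_mul] at h
  have h8 : jensenPoly xiTaylorCoeff d 0 =
      Polynomial.C (8 : ℝ) * (Polynomial.C (8⁻¹ : ℝ) * jensenPoly xiTaylorCoeff d 0) := by
    rw [← mul_assoc, ← C_mul, mul_inv_cancel₀ (by norm_num : (8 : ℝ) ≠ 0), C_1, one_mul]
  rw [h8]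
  exact h.C_mul 8

/-! ## `GORZ2019_chasse` from the Platt–Trudgian verification -/

/-- **Kim–Lee's range from Platt–Trudgian** (Kim–Lee 2021, p. 2: "`J(Ξ₀⁽ⁿ⁾; d)` is hyperbolic for
`d ≤ 9·10^24`", here the case `n = 0`): the tree's named fact
`Literature.NumberTheory.LFunctions.platt_trudgian_numerical_rh` (RH to height `H = 3 000 175 332 800`,
Platt–Trudgian 2021 Thm. 1) gives hyperbolicity of `J^{d,0}_γ` for all `d ≤ 9·10^24 ≤ H²`.
[cite: KimLee2021, Remark after Theorem 4 (p. 2)] [cite: PlattTrudgianBLMS2021, Theorem 1] -/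
theorem jensenPoly_xiTaylorCoeff_splits_of_platt_trudgian (h : platt_trudgian_numerical_rh)
    {d : ℕ} (hd : d ≤ 9 * 10 ^ 24) : (jensenPoly xiTaylorCoeff d 0).Splits := by
  refine jensenPoly_xiTaylorCoeff_splits_of_rh_upTo (T := 3000175332800) (by norm_num)
    (fun s hs h0 hT => h s hs h0 hT.le) ?_
  have : (d : ℝ) ≤ 9 * 10 ^ 24 := by exact_mod_cast hd
  linarith

/-- **`GORZ2019_chasse` follows from the Platt–Trudgian numerical verification of RH** (the
computational input `platt_trudgian_numerical_rh`, rh.S35, is the only unproved ingredient; GORZ's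
footnote cites Chasse's Thm. 1.8, whose own input was an earlier verification to height
`≈ 4.5·10^8 = √(2·10^17)`). [cite: GORZPNAS2019, §1 (footnote)] [cite: PlattTrudgianBLMS2021, Theorem 1] -/
theorem GORZ2019_chasse_of_platt_trudgian_numerical_rh (h : platt_trudgian_numerical_rh) :
    GORZ2019_chasse := fun _ hd =>
  jensenPoly_xiTaylorCoeff_splits_of_platt_trudgian h (hd.trans (by norm_num))

end Literature.Barriers.RiemannHypothesis
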